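import Summits.MatrixMultiplication.OmegaCensus.STPPSmallPatternT1Below24

/-!
# ω-census, small STPP pattern `(2,1,1)^k`, `k ≤ 4`: the `T1` onsets `6 / 12 / 16 (18 cyclic)` over all finite abelian groups (kernel)

HONEST FRAMING (pub-omega census; verbatim): lottery ticket; floor = certified bounds/negative ranges.
Census STRUCTURE bookkeeping of the STPP track (seat pub-omega-stpp-3, gen 23; STRUCTURE row B5, threshold column `T1`),
not progress on `ω`.

Companion of `STPPSmallPatternT1Below24.lean` (`k = 5`: onset `24`) for the smaller pattern lengths, by the same bridge
(`not_exists_isSTPP_211_of_card_le_23` fed with a kernel domination core and the per-group kernel cells):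
* `not_exists_isSTPP_211pow4_of_card_le` — no finite abelian group of order `≤ 15` admits `(2,1,1)⁴`; `ℤ/2 × ℤ/8` (order 16) and
  `ℤ/18` do (kernel witnesses below), `ℤ/16`, `ℤ/17` do not (cells): all-abelian onset `16`, cyclic onset `18`;
* `not_exists_isSTPP_211pow3_of_card_le` — order `≤ 11`: no `(2,1,1)³`; `ℤ/12` hosts it: onset `12`;
* `not_exists_isSTPP_211pow2_of_card_le` — order `≤ 5`: no `(2,1,1)²`; `ℤ/6` hosts it: onset `6`.
Witness families found by the seat's mirror of the kernel engine and CHECKED IN THE KERNEL by the tree's Boolean Def-5.1 checker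
(`exists_isSTPP_of_lists_cards`, `STPPSmallPatternWitnesses.lean`).

References: H. Cohn, R. Kleinberg, B. Szegedy, C. Umans, FOCS 2005 (arXiv:math/0511460), Def. 5.1.  Record: pub-omega HOME
`pub-omega-stpp-3-g23/`.
-/

open Literature.Computability.AlgebraicComplexity Finset

namespace Summit.MatrixMultiplication.OmegaCensus

/-! ## 1. `k = 4`: the twelve abelian groups of order `8 … 15` -/

/-- The abelian groups of order `8 … 15`, as lists of prime-power moduli. -/
def noneLists211K4 : List (List ℕ) :=
  [[8], [2, 4], [2, 2, 2], [9], [3, 3], [2, 5], [11], [4, 3], [2, 2, 3], [13], [2, 7], [3, 5]]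

/-- COMBINATORIAL CORE for `k = 4` (kernel). -/
theorem noneList211K4_of_capped : ∀ E ∈ List.range' 1 23, ∀ M ∈ subMS (capList26 E), 2 * 4 ≤ M.prod → M.prod ≤ 15 →
    ∃ s ∈ noneLists211K4, dom s M = true ∧ s.prod = M.prod := by
  decide +kernel

/-- Each of the twelve groups admits no `(2,1,1)⁴` (kernel cells; order-8/9 products lifted from their `k = 3` cells).
[cite: CohnKleinbergSzegedyUmans2005, Def. 5.1] -/
theorem not_211pow4_of_mem_noneLists211K4 : ∀ s ∈ noneLists211K4, ¬ ∃ A B C : Fin 4 → Finset (SeedType s),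
    IsSTPP A B C ∧ ∀ i, (A i).card = 2 ∧ (B i).card = 1 ∧ (C i).card = 1 := by
  intro s hs
  simp only [noneLists211K4, List.mem_cons, List.mem_nil_iff, or_false] at hs
  rcases hs with rfl | rfl | rfl | rfl | rfl | rfl | rfl | rfl | rfl | rfl | rfl | rfl
  · exact not_exists_isSTPP_211pow4_zmod8
  · exact not_exists_isSTPP_211_mono (by norm_num) not_exists_isSTPP_211pow3_z2_z4
  · exact not_exists_isSTPP_211_mono (by norm_num) not_exists_isSTPP_211pow3_z2_z2_z2
  · exact not_exists_isSTPP_211pow4_zmod9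
  · exact not_exists_isSTPP_211_mono (by norm_num) not_exists_isSTPP_211pow3_z3_z3
  · exact not_exists_isSTPP_211_seedPair (by norm_num) not_exists_isSTPP_211pow4_zmod10
  · exact not_exists_isSTPP_211pow4_zmod11
  · exact not_exists_isSTPP_211_seedPair (by norm_num) not_exists_isSTPP_211pow4_zmod12
  · exact not_exists_isSTPP_211pow4_z2_z2_z3
  · exact not_exists_isSTPP_211pow4_zmod13
  · exact not_exists_isSTPP_211_seedPair (by norm_num) not_exists_isSTPP_211pow4_zmod14
  · exact not_exists_isSTPP_211_seedPair (by norm_num) not_exists_isSTPP_211pow4_zmod15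

/-- The generic bridge with an upper order bound `hi ≤ 23` (orders `< 2k` by packing). [cite: CohnKleinbergSzegedyUmans2005, Def. 5.1] -/
theorem not_exists_isSTPP_211_of_card_le_hi {k hi : ℕ} (hhi : hi ≤ 23) {L : List (List ℕ)}
    (hcore : ∀ E ∈ List.range' 1 23, ∀ M ∈ subMS (capList26 E), 2 * k ≤ M.prod → M.prod ≤ hi →
      ∃ s ∈ L, dom s M = true ∧ s.prod = M.prod)
    (hnone : ∀ s ∈ L, ¬ ∃ A B C : Fin k → Finset (SeedType s), IsSTPP A B C ∧
      ∀ i, (A i).card = 2 ∧ (B i).card = 1 ∧ (C i).card = 1)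
    {G : Type*} [AddCommGroup G] [Finite G] (hG : Nat.card G ≤ hi) :
    ¬ ∃ A B C : Fin k → Finset G, IsSTPP A B C ∧ ∀ i, (A i).card = 2 ∧ (B i).card = 1 ∧ (C i).card = 1 := by
  -- shrink the window of the core to `[2k, 23]` by discarding multisets of product `> hi` (they do not occur: `|G| ≤ hi`)
  classical
  rintro ⟨A, B, C, hS, hc⟩
  have hlo : 2 * k ≤ Nat.card G := two_mul_le_natCard_of_isSTPP_211 ⟨A, B, C, hS, hc⟩
  obtain ⟨ι, _, p, hp, e, ⟨g⟩⟩ := AddCommGroup.equiv_directSum_zmod_of_finite G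
  let f : G ≃+ (Π i, ZMod (p i ^ e i)) :=
    g.trans (DirectSum.linearEquivFunOnFintype ℕ ι (fun i => ZMod (p i ^ e i))).toAddEquiv
  have hE1 : 1 ≤ AddMonoid.exponent G := Nat.pos_of_ne_zero AddMonoid.exponent_ne_zero_of_finite
  have hEle : AddMonoid.exponent G ≤ 23 :=
    le_trans (Nat.le_of_dvd Nat.card_pos AddGroup.exponent_dvd_nat_card) (le_trans hG hhi)
  have hdvd : ∀ i, p i ^ e i ∣ AddMonoid.exponent G := fun i => by
    have hinj : Function.Injective (AddMonoidHom.single (fun j => ZMod (p j ^ e j)) i) :=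
      Pi.single_injective (M := fun j => ZMod (p j ^ e j)) i
    have h1 : addOrderOf (f.symm (AddMonoidHom.single (fun j => ZMod (p j ^ e j)) i 1)) = p i ^ e i := by
      rw [AddEquiv.addOrderOf_eq, addOrderOf_injective _ hinj, ZMod.addOrderOf_one]
    rw [← h1]
    exact AddMonoid.addOrder_dvd_exponent _
  have hcardeq : Nat.card G = ∏ i, p i ^ e i := by
    rw [Nat.card_congr f.toEquiv, Nat.card_pi]
    simp [Nat.card_zmod]
  have hcore' : ∀ E ∈ List.range' 1 23, ∀ M ∈ subMS (capList26 E), 2 * k ≤ M.prod → M.prod ≤ 23 →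
      M.prod = Nat.card G → ∃ s ∈ L, dom s M = true ∧ s.prod = M.prod :=
    fun E hE M hM h1 _ h3 => hcore E hE M hM h1 (by rw [h3]; exact hG)
  -- rerun the product case with the extra equation (copy of `not_exists_isSTPP_211_pi` with `M.prod = |G|` threaded)
  have hq0 : ∀ i, p i ^ e i ≠ 0 := fun i => pow_ne_zero _ (hp i).ne_zero
  haveI : ∀ i, NeZero (p i ^ e i) := fun i => ⟨hq0 i⟩
  set M : Multiset ℕ := (Finset.univ.filter fun i => 0 < e i).val.map fun i => p i ^ e i with hM
  have hprodeq : M.prod = ∏ i, p i ^ e i := by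
    rw [hM, ← Finset.prod_eq_multiset_prod]
    exact Finset.prod_filter_of_ne fun i _ hi => Nat.pos_of_ne_zero fun h0 => hi (by rw [h0, pow_zero])
  have hmem : ∀ a ∈ M, a ∈ ppList23 ∧ a ∣ AddMonoid.exponent G := by
    intro a ha
    obtain ⟨i, hi, rfl⟩ := Multiset.mem_map.1 ha
    have hi' : 0 < e i := (Finset.mem_filter.1 hi).2
    exact ⟨pow_mem_ppList23 (hp i) hi' (le_trans (Nat.le_of_dvd (by omega) (hdvd i)) hEle), hdvd i⟩
  have hEI : AddMonoid.exponent G ∈ List.range' 1 23 := List.mem_range'_1.2 ⟨hE1, by omega⟩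
  have h23 : M.prod ≤ 23 := by rw [hprodeq, ← hcardeq]; omega
  have hle : M ≤ capMS (capList26 (AddMonoid.exponent G)) :=
    le_capMS_of_prod_le hEI (fun a ha => (hmem a ha).1) (fun a ha => (hmem a ha).2) h23
  obtain ⟨s, hs, hD, hsprod⟩ := hcore' _ hEI M (mem_subMS_of_le _ _ hle) (by rw [hprodeq, ← hcardeq]; exact hlo) h23
    (by rw [hprodeq, hcardeq])
  obtain ⟨φ, hφ, -⟩ := exists_emb_of_dom (fun i => p i ^ e i) hq0 s _ hD
  have hcard : Nat.card (SeedType s) = Nat.card (Π i, ZMod (p i ^ e i)) := by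
    rw [card_seedType, hsprod, hprodeq, Nat.card_pi]
    simp
  exact not_exists_isSTPP_211_of_card_eq φ hφ hcard (hnone s hs)
    (exists_isSTPP_211_of_injective f.toAddMonoidHom f.injective ⟨A, B, C, hS, hc⟩)

/-- **No finite abelian group of order `≤ 15` admits `(2,1,1)⁴`** (CKSU Def. 5.1; kernel). [cite: CohnKleinbergSzegedyUmans2005, Def. 5.1] -/
theorem not_exists_isSTPP_211pow4_of_card_le {G : Type*} [AddCommGroup G] [Finite G] (hG : Nat.card G ≤ 15) :
    ¬ ∃ A B C : Fin 4 → Finset G, IsSTPP A B C ∧ ∀ i, (A i).card = 2 ∧ (B i).card = 1 ∧ (C i).card = 1 :=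
  not_exists_isSTPP_211_of_card_le_hi (by norm_num) noneList211K4_of_capped not_211pow4_of_mem_noneLists211K4 hG

/-- `(2,1,1)⁴ ⊆ ℤ/2 × ℤ/8` (order 16; kernel-checked witness). [cite: CohnKleinbergSzegedyUmans2005, Def. 5.1] -/
theorem exists_isSTPP_211pow4_zmod2_zmod8 :
    ∃ A B C : Fin 4 → Finset (ZMod 2 × ZMod 8), IsSTPP A B C ∧ ∀ i, (A i).card = 2 ∧ (B i).card = 1 ∧ (C i).card = 1 :=
  exists_isSTPP_of_lists_cards (H := ZMod 2 × ZMod 8)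
    ![[(0, 0), (1, 0)], [(0, 1), (1, 5)], [(0, 3), (1, 7)], [(0, 6), (1, 6)]]
    ![[(0, 0)], [(0, 0)], [(0, 0)], [(0, 0)]]
    ![[(0, 0)], [(0, 2)], [(1, 2)], [(1, 4)]]
    (by decide +kernel) (by decide +kernel)

/-- `(2,1,1)⁴ ⊆ ℤ/18` (the cyclic onset; kernel-checked witness). [cite: CohnKleinbergSzegedyUmans2005, Def. 5.1] -/
theorem exists_isSTPP_211pow4_zmod18 :
    ∃ A B C : Fin 4 → Finset (ZMod 18), IsSTPP A B C ∧ ∀ i, (A i).card = 2 ∧ (B i).card = 1 ∧ (C i).card = 1 :=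
  exists_isSTPP_of_lists_cards (H := ZMod 18)
    ![[0, 1], [4, 5], [12, 13], [16, 17]] ![[0], [0], [0], [0]] ![[0], [2], [6], [8]]
    (by decide +kernel) (by decide +kernel)

/-- **ONSETS of `(2,1,1)⁴` (kernel both ways):** no abelian group of order `≤ 15` hosts it, `ℤ/2 × ℤ/8` (order `16`) does; among
cyclic groups `ℤ/16`, `ℤ/17` do not and `ℤ/18` does. [cite: CohnKleinbergSzegedyUmans2005, Def. 5.1] -/
theorem stpp211pow4_onsets :
    (∀ (G : Type) [AddCommGroup G] [Finite G], Nat.card G ≤ 15 →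
      ¬ ∃ A B C : Fin 4 → Finset G, IsSTPP A B C ∧ ∀ i, (A i).card = 2 ∧ (B i).card = 1 ∧ (C i).card = 1) ∧
    (∃ A B C : Fin 4 → Finset (ZMod 2 × ZMod 8), IsSTPP A B C ∧ ∀ i, (A i).card = 2 ∧ (B i).card = 1 ∧ (C i).card = 1) ∧
    (¬ ∃ A B C : Fin 4 → Finset (ZMod 16), IsSTPP A B C ∧ ∀ i, (A i).card = 2 ∧ (B i).card = 1 ∧ (C i).card = 1) ∧
    (¬ ∃ A B C : Fin 4 → Finset (ZMod 17), IsSTPP A B C ∧ ∀ i, (A i).card = 2 ∧ (B i).card = 1 ∧ (C i).card = 1) ∧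
    ∃ A B C : Fin 4 → Finset (ZMod 18), IsSTPP A B C ∧ ∀ i, (A i).card = 2 ∧ (B i).card = 1 ∧ (C i).card = 1 :=
  ⟨fun _ _ _ hG => not_exists_isSTPP_211pow4_of_card_le hG, exists_isSTPP_211pow4_zmod2_zmod8,
    not_exists_isSTPP_211pow4_zmod16, not_exists_isSTPP_211pow4_zmod17, exists_isSTPP_211pow4_zmod18⟩

/-! ## 2. `k = 3`: the nine abelian groups of order `6 … 11` -/

/-- The abelian groups of order `6 … 11`, as lists of prime-power moduli. -/
def noneLists211K3 : List (List ℕ) := [[2, 3], [7], [8], [2, 4], [2, 2, 2], [9], [3, 3], [2, 5], [11]]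

/-- COMBINATORIAL CORE for `k = 3` (kernel). -/
theorem noneList211K3_of_capped : ∀ E ∈ List.range' 1 23, ∀ M ∈ subMS (capList26 E), 2 * 3 ≤ M.prod → M.prod ≤ 11 →
    ∃ s ∈ noneLists211K3, dom s M = true ∧ s.prod = M.prod := by
  decide +kernel

/-- Each of the nine groups admits no `(2,1,1)³` (kernel cells). [cite: CohnKleinbergSzegedyUmans2005, Def. 5.1] -/
theorem not_211pow3_of_mem_noneLists211K3 : ∀ s ∈ noneLists211K3, ¬ ∃ A B C : Fin 3 → Finset (SeedType s),
    IsSTPP A B C ∧ ∀ i, (A i).card = 2 ∧ (B i).card = 1 ∧ (C i).card = 1 := by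
  intro s hs
  simp only [noneLists211K3, List.mem_cons, List.mem_nil_iff, or_false] at hs
  rcases hs with rfl | rfl | rfl | rfl | rfl | rfl | rfl | rfl | rfl
  · exact not_exists_isSTPP_211_seedPair (by norm_num) not_exists_isSTPP_211pow3_zmod6
  · exact not_exists_isSTPP_211pow3_zmod7
  · exact not_exists_isSTPP_211pow3_zmod8
  · exact not_exists_isSTPP_211pow3_z2_z4
  · exact not_exists_isSTPP_211pow3_z2_z2_z2
  · exact not_exists_isSTPP_211pow3_zmod9
  · exact not_exists_isSTPP_211pow3_z3_z3
  · exact not_exists_isSTPP_211_seedPair (by norm_num) not_exists_isSTPP_211pow3_zmod10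
  · exact not_exists_isSTPP_211pow3_zmod11

/-- **No finite abelian group of order `≤ 11` admits `(2,1,1)³`** (kernel). [cite: CohnKleinbergSzegedyUmans2005, Def. 5.1] -/
theorem not_exists_isSTPP_211pow3_of_card_le {G : Type*} [AddCommGroup G] [Finite G] (hG : Nat.card G ≤ 11) :
    ¬ ∃ A B C : Fin 3 → Finset G, IsSTPP A B C ∧ ∀ i, (A i).card = 2 ∧ (B i).card = 1 ∧ (C i).card = 1 :=
  not_exists_isSTPP_211_of_card_le_hi (by norm_num) noneList211K3_of_capped not_211pow3_of_mem_noneLists211K3 hG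

/-- `(2,1,1)³ ⊆ ℤ/12` (kernel-checked witness). [cite: CohnKleinbergSzegedyUmans2005, Def. 5.1] -/
theorem exists_isSTPP_211pow3_zmod12 :
    ∃ A B C : Fin 3 → Finset (ZMod 12), IsSTPP A B C ∧ ∀ i, (A i).card = 2 ∧ (B i).card = 1 ∧ (C i).card = 1 :=
  exists_isSTPP_of_lists_cards (H := ZMod 12) ![[0, 1], [4, 10], [9, 11]] ![[0], [0], [0]] ![[0], [2], [6]]
    (by decide +kernel) (by decide +kernel)

/-- **ONSET of `(2,1,1)³` = 12** (kernel both ways). [cite: CohnKleinbergSzegedyUmans2005, Def. 5.1] -/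
theorem stpp211pow3_onset_eq_12 :
    (∀ (G : Type) [AddCommGroup G] [Finite G], Nat.card G ≤ 11 →
      ¬ ∃ A B C : Fin 3 → Finset G, IsSTPP A B C ∧ ∀ i, (A i).card = 2 ∧ (B i).card = 1 ∧ (C i).card = 1) ∧
    ∃ A B C : Fin 3 → Finset (ZMod 12), IsSTPP A B C ∧ ∀ i, (A i).card = 2 ∧ (B i).card = 1 ∧ (C i).card = 1 :=
  ⟨fun _ _ _ hG => not_exists_isSTPP_211pow3_of_card_le hG, exists_isSTPP_211pow3_zmod12⟩

/-! ## 3. `k = 2`: the three abelian groups of order `4, 5` -/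

/-- The abelian groups of order `4 … 5`, as lists of prime-power moduli. -/
def noneLists211K2 : List (List ℕ) := [[4], [2, 2], [5]]

/-- COMBINATORIAL CORE for `k = 2` (kernel). -/
theorem noneList211K2_of_capped : ∀ E ∈ List.range' 1 23, ∀ M ∈ subMS (capList26 E), 2 * 2 ≤ M.prod → M.prod ≤ 5 →
    ∃ s ∈ noneLists211K2, dom s M = true ∧ s.prod = M.prod := by
  decide +kernel

/-- Each of the three groups admits no `(2,1,1)²` (kernel cells). [cite: CohnKleinbergSzegedyUmans2005, Def. 5.1] -/
theorem not_211pow2_of_mem_noneLists211K2 : ∀ s ∈ noneLists211K2, ¬ ∃ A B C : Fin 2 → Finset (SeedType s),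
    IsSTPP A B C ∧ ∀ i, (A i).card = 2 ∧ (B i).card = 1 ∧ (C i).card = 1 := by
  intro s hs
  simp only [noneLists211K2, List.mem_cons, List.mem_nil_iff, or_false] at hs
  rcases hs with rfl | rfl | rfl
  · exact not_exists_isSTPP_211pow2_zmod4
  · exact not_exists_isSTPP_211pow2_z2_z2
  · exact not_exists_isSTPP_211pow2_zmod5

/-- **No finite abelian group of order `≤ 5` admits `(2,1,1)²`** (kernel). [cite: CohnKleinbergSzegedyUmans2005, Def. 5.1] -/
theorem not_exists_isSTPP_211pow2_of_card_le {G : Type*} [AddCommGroup G] [Finite G] (hG : Nat.card G ≤ 5) :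
    ¬ ∃ A B C : Fin 2 → Finset G, IsSTPP A B C ∧ ∀ i, (A i).card = 2 ∧ (B i).card = 1 ∧ (C i).card = 1 :=
  not_exists_isSTPP_211_of_card_le_hi (by norm_num) noneList211K2_of_capped not_211pow2_of_mem_noneLists211K2 hG

/-- `(2,1,1)² ⊆ ℤ/6` (kernel-checked witness). [cite: CohnKleinbergSzegedyUmans2005, Def. 5.1] -/
theorem exists_isSTPP_211pow2_zmod6 :
    ∃ A B C : Fin 2 → Finset (ZMod 6), IsSTPP A B C ∧ ∀ i, (A i).card = 2 ∧ (B i).card = 1 ∧ (C i).card = 1 :=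
  exists_isSTPP_of_lists_cards (H := ZMod 6) ![[0, 1], [4, 5]] ![[0], [0]] ![[0], [2]]
    (by decide +kernel) (by decide +kernel)

/-- **ONSET of `(2,1,1)²` = 6** (kernel both ways). [cite: CohnKleinbergSzegedyUmans2005, Def. 5.1] -/
theorem stpp211pow2_onset_eq_6 :
    (∀ (G : Type) [AddCommGroup G] [Finite G], Nat.card G ≤ 5 →
      ¬ ∃ A B C : Fin 2 → Finset G, IsSTPP A B C ∧ ∀ i, (A i).card = 2 ∧ (B i).card = 1 ∧ (C i).card = 1) ∧
    ∃ A B C : Fin 2 → Finset (ZMod 6), IsSTPP A B C ∧ ∀ i, (A i).card = 2 ∧ (B i).card = 1 ∧ (C i).card = 1 :=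
  ⟨fun _ _ _ hG => not_exists_isSTPP_211pow2_of_card_le hG, exists_isSTPP_211pow2_zmod6⟩

end Summit.MatrixMultiplication.OmegaCensus
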